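/-
Copyright (c) 2026. All rights reserved.
Released under Apache 2.0 license as described in the file LICENSE.
-/
import Literature.Geometry.Kaehler.ComplexTorusQuaternionXSixRamification
import Literature.Geometry.Kaehler.ComplexTorusQuaternionXSixSpecialCyclesPrimitiveDegrees
import Literature.NumberTheory.Automorphic.BrandtModuleLocal
import HarnessLib

/-!
# `h(O₆) = 1` in the lattice language and the classes of ideals through a special vector:
# `|L(m)/O₆^×| = #(Brandt.ThroughClass O₆ γ)` for every pure `γ ∈ B` of reduced norm `m`

Third file of the Eichler-count plan for the X₆ special cycles (after `…XSixMaximalOrderLattice` — `O₆` as a maximal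
`ℤ`-order `span ℤ {e, i, j, ij}` of the division algebra `B = (−1,3)_ℚ` — and `…XSixRamification`). The tree's Eichler
trace formula (`Brandt.card_throughClass_optimalOrder_eq_of_isUnit`, Vignéras III.5.11 proof (1)) counts
`Brandt.ThroughClass O γ`: classes, modulo left multiplication by `ℚ(γ)ˣ`, of invertible right `O`-ideals `J` whose left
order contains `γ`. Vignéras' second evaluation (III.5.11 (2), the tree's `Brandt.CoreHyp.orbitEquiv`) identifies, class of
`O` by class, these with conjugacy classes of elements: `x = bγb⁻¹ ∈ O_L(I) ↦ [b⁻¹I]`. For `O = O₆` there is ONE ideal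
class (the series' `exists_generator_of_rightIdeal`: `O₆` is norm-Euclidean, Cerri–Chaubert–Lezowski), so:

* §1 **`exists_eq_units_smul_of_mem_rightIdeals`**: every invertible right `O₆`-ideal (every full lattice `J` with
  `O_R(J) = O₆`) is PRINCIPAL, `J = bO₆`, `b ∈ Bˣ`; `maxOrderLattice_mem_rightIdeals`, `units_smul_mem_rightIdeals`,
  **`classSet_mk_eq`** (`Brandt.ClassSet O₆` is a point: `[J] = [O₆]`), `coreHyp_maxOrderLattice`.
* §2 the element side: for a pure `γ ∈ B` (`re γ = 0`) with `nr γ = m`, **`mem_traceNormSet_maxOrderLattice_iff`**: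
  `Brandt.traceNormSet O₆ (trd γ) (nrd γ) = {ŷ : y ∈ L(m)}` (`L(m) = {y ∈ ℤ³ : y₁² − 3y₂² − 3y₃² = m}` of the series;
  `trd = 0`, `nrd = m`, and a trace-zero element of `O₆` has integral coordinates), and the stabiliser of the lattice
  `O₆` in `Bˣ` is the series' unit group (`…MaximalOrderLattice.units_smul_maxOrderLattice_eq_iff`).
* §3 **`card_throughClass_eq_card_unit_classes`**: `#(ThroughClass O₆ γ) = |L(m)/O₆^×|` — the classes of ideals through
  `γ` modulo `ℚ(γ)ˣ` are equinumerous with KRY's index set of (3.4.13), the `O₆^×`-conjugacy classes of special vectors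
  of norm `m` (the map `[y] ↦ ψ(ŷ) = [b_ŷ⁻¹O₆]`, `b_ŷ γ b_ŷ⁻¹ = ŷ`, is a bijection: `psi_pureVec_eq_iff`,
  `exists_pureVec_psi_eq`).

## Sources

* M.-F. Vignéras, *Arithmétique des algèbres de quaternions*, LNM 800 (1980), Ch. III §5 Thm. 5.11 (proof, (2): «le
  nombre `card(G_A∖T_A/L^•)` … est égal au nombre des classes de conjugaison modulo `G` des éléments … de polynôme
  caractéristique donné»), Cor. 5.13–5.14; Ch. I §4 (idéaux, classes). [cite: VignerasLNM800, Ch. III §5 Thm. 5.11 (proof (2)) and Cor. 5.13–5.14]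
* J.-P. Cerri, J. Chaubert, P. Lezowski, *Totally indefinite Euclidean quaternion fields*, Acta Arith. 165 (2014),
  Prop. 2.5 (iii) («if `Λ` is Euclidean, then `h_F = 1`»). [cite: CerriChaubertLezowski2014, Prop. 2.5 (iii)]
* S. Kudla, M. Rapoport, T. Yang, *Modular Forms and Special Cycles on Shimura Curves* (2006), §3.4 (3.4.8), (3.4.13)
  (`L(t)`, `Γ = O_B^×`-orbits). [cite: KudlaRapoportYang2006, §3.4 (3.4.8) and (3.4.13)]

## Scope (honest)

Theorems only — no definition, no named fact, no instance; bijections are stated as `Nat.card` identities (and the map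
`[y] ↦ ψ(ŷ)` through the tree's `Brandt.CoreHyp.psi`). The optimal orders of these classes (primitive vectors) are the
subject of the sequel.
-/

set_option maxSynthPendingDepth 3

open Quaternion Function
open scoped Pointwise
open Literature.NumberTheory.Automorphic Literature.NumberTheory.Automorphic.Brandt

namespace Literature.Geometry.Kaehler.ComplexTorus.QuaternionType

/-! ## §1 Every right `O₆`-ideal is principal: `Brandt.ClassSet O₆` is a point -/

section Principal

/-- `2·O₆ ⊆ 𝔬`: twice an element of the maximal order has integral coordinates. [cite: BayerTravesa2007, §1 p. 316] -/
private theorem two_smul_mem_order₆₂ {y : ℍ[ℚ,((-1 : ℤ) : ℚ),((3 : ℤ) : ℚ)]} (hy : (y ∈ order (-1) 3 ∨ y - ⟨1/2, 1/2, 1/2, -1/2⟩ ∈ order (-1) 3)) : (2 : ℚ) • y ∈ order (-1) 3 := by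
  obtain ⟨n, rfl, -, -, -⟩ := (maxOrder_iff_exists_halfCoords y).1 hy
  refine ⟨n, ?_⟩
  rw [QuaternionAlgebra.smul_mk]
  unfold ofCoords
  rw [QuaternionAlgebra.mk.injEq]
  refine ⟨?_, ?_, ?_, ?_⟩ <;> simp only [smul_eq_mul] <;> ring

/-- **EVERY INVERTIBLE RIGHT `O₆`-IDEAL IS PRINCIPAL: `J = bO₆`, `b ∈ Bˣ`** (`h(O₆) = 1`; the series'
`exists_generator_of_rightIdeal`, i.e. the Euclidean algorithm in `O₆`, read on `Brandt.rightIdeals`).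
[cite: CerriChaubertLezowski2014, Prop. 2.5 (iii)] [cite: VignerasLNM800, Ch. I §4 (idéaux principaux)] -/
theorem exists_eq_units_smul_of_mem_rightIdeals {I : Submodule ℤ ℍ[ℚ,((-1 : ℤ) : ℚ),((3 : ℤ) : ℚ)]} (hI : I ∈ rightIdeals (Submodule.span ℤ (Set.range ![(⟨1/2, 1/2, 1/2, -1/2⟩ : ℍ[ℚ,((-1 : ℤ) : ℚ),((3 : ℤ) : ℚ)]), ⟨0, 1, 0, 0⟩, ⟨0, 0, 1, 0⟩, ⟨0, 0, 0, 1⟩]))) :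
    ∃ b : (ℍ[ℚ,((-1 : ℤ) : ℚ),((3 : ℤ) : ℚ)])ˣ, I = b • (Submodule.span ℤ (Set.range ![(⟨1/2, 1/2, 1/2, -1/2⟩ : ℍ[ℚ,((-1 : ℤ) : ℚ),((3 : ℤ) : ℚ)]), ⟨0, 1, 0, 0⟩, ⟨0, 0, 1, 0⟩, ⟨0, 0, 0, 1⟩])) := by
  obtain ⟨hfull, hright, -⟩ := hI
  have hmul : ∀ x ∈ I.toAddSubgroup, ∀ g : ℍ[ℚ,((-1 : ℤ) : ℚ),((3 : ℤ) : ℚ)], (g ∈ order (-1) 3 ∨ g - ⟨1/2, 1/2, 1/2, -1/2⟩ ∈ order (-1) 3) → x * g ∈ I.toAddSubgroup := by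
    intro x hx g hg
    have hg' : g ∈ rightOrder I := by rw [hright]; exact (mem_maxOrderLattice_iff g).2 hg
    exact hg' x hx
  have hne : ∃ x ∈ I.toAddSubgroup, x ≠ 0 := by
    obtain ⟨n, hn0, hn⟩ := hfull.2 1
    refine ⟨_, hn, fun h => hn0 ?_⟩
    have h' : ((n : ℤ) : ℚ) = 0 := by
      have := congrArg QuaternionAlgebra.re h
      rwa [← Int.cast_smul_eq_zsmul ℚ, QuaternionAlgebra.re_smul, QuaternionAlgebra.re_one, smul_eq_mul, mul_one,
        QuaternionAlgebra.re_zero] at this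
    exact_mod_cast h'
  obtain ⟨N, hN0, hN⟩ := exists_nat_smul_mem_of_fg isFullLattice_maxOrderLattice hfull.1
  have hlat : ∀ x ∈ I.toAddSubgroup, ((2 * N : ℕ) : ℚ) • x ∈ order (-1) 3 := by
    intro x hx
    have h1 : (N : ℤ) • x ∈ (Submodule.span ℤ (Set.range ![(⟨1/2, 1/2, 1/2, -1/2⟩ : ℍ[ℚ,((-1 : ℤ) : ℚ),((3 : ℤ) : ℚ)]), ⟨0, 1, 0, 0⟩, ⟨0, 0, 1, 0⟩, ⟨0, 0, 0, 1⟩])) := hN x hx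
    rw [mem_maxOrderLattice_iff] at h1
    have h2 := two_smul_mem_order₆₂ h1
    rwa [← Int.cast_smul_eq_zsmul ℚ, smul_smul,
      show (2 : ℚ) * ((N : ℤ) : ℚ) = ((2 * N : ℕ) : ℚ) by push_cast; ring] at h2
  obtain ⟨α, hαI, hα0, hgen⟩ :=
    exists_generator_of_rightIdeal I.toAddSubgroup hmul hne (by positivity : 0 < 2 * N) hlat
  obtain ⟨b, hb⟩ := isUnit_of_ne_zero hα0
  refine ⟨b, ?_⟩
  ext β
  rw [mem_units_smul_submodule_iff, mem_maxOrderLattice_iff, show (β ∈ I ↔ β ∈ I.toAddSubgroup) from Iff.rfl, hgen β]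
  constructor
  · rintro ⟨g, hg, rfl⟩
    rwa [Units.smul_def, smul_eq_mul, ← hb, ← mul_assoc, Units.inv_mul, one_mul]
  · intro h
    exact ⟨_, h, by rw [Units.smul_def, smul_eq_mul, ← hb, ← mul_assoc, Units.mul_inv, one_mul]⟩

/-- **`O₆` is an invertible right `O₆`-ideal** (the trivial class). [cite: VignerasLNM800, Ch. I §4 (idéaux)] -/
theorem maxOrderLattice_mem_rightIdeals : (Submodule.span ℤ (Set.range ![(⟨1/2, 1/2, 1/2, -1/2⟩ : ℍ[ℚ,((-1 : ℤ) : ℚ),((3 : ℤ) : ℚ)]), ⟨0, 1, 0, 0⟩, ⟨0, 0, 1, 0⟩, ⟨0, 0, 0, 1⟩])) ∈ rightIdeals (Submodule.span ℤ (Set.range ![(⟨1/2, 1/2, 1/2, -1/2⟩ : ℍ[ℚ,((-1 : ℤ) : ℚ),((3 : ℤ) : ℚ)]), ⟨0, 1, 0, 0⟩, ⟨0, 0, 1, 0⟩, ⟨0, 0, 0, 1⟩])) := by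
  haveI := isQuaternionAlgebra_neg_one_three
  haveI : IsAddTorsionFree ℍ[ℚ,((-1 : ℤ) : ℚ),((3 : ℤ) : ℚ)] := isAddTorsionFree_of_charZero_module ℚ ℍ[ℚ,((-1 : ℤ) : ℚ),((3 : ℤ) : ℚ)]
  exact mem_rightIdeals_of_isInvertibleRightIdeal forall_isUnit_neg_one_three isZOrder_maxOrderLattice
    isZOrder_maxOrderLattice.isInvertibleRightIdeal_self

/-- Translates `βJ` of invertible right `O₆`-ideals are invertible right `O₆`-ideals. [cite: VignerasLNM800, Ch. I §4 Lemme 4.3] -/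
theorem units_smul_mem_rightIdeals {I : Submodule ℤ ℍ[ℚ,((-1 : ℤ) : ℚ),((3 : ℤ) : ℚ)]} (hI : I ∈ rightIdeals (Submodule.span ℤ (Set.range ![(⟨1/2, 1/2, 1/2, -1/2⟩ : ℍ[ℚ,((-1 : ℤ) : ℚ),((3 : ℤ) : ℚ)]), ⟨0, 1, 0, 0⟩, ⟨0, 0, 1, 0⟩, ⟨0, 0, 0, 1⟩]))) (β : (ℍ[ℚ,((-1 : ℤ) : ℚ),((3 : ℤ) : ℚ)])ˣ) :
    β • I ∈ rightIdeals (Submodule.span ℤ (Set.range ![(⟨1/2, 1/2, 1/2, -1/2⟩ : ℍ[ℚ,((-1 : ℤ) : ℚ),((3 : ℤ) : ℚ)]), ⟨0, 1, 0, 0⟩, ⟨0, 0, 1, 0⟩, ⟨0, 0, 0, 1⟩])) := by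
  haveI := isQuaternionAlgebra_neg_one_three
  haveI : IsAddTorsionFree ℍ[ℚ,((-1 : ℤ) : ℚ),((3 : ℤ) : ℚ)] := isAddTorsionFree_of_charZero_module ℚ ℍ[ℚ,((-1 : ℤ) : ℚ),((3 : ℤ) : ℚ)]
  rw [rightIdeals_eq_invertibleRightIdeals forall_isUnit_neg_one_three isZOrder_maxOrderLattice] at hI ⊢
  exact IsInvertibleRightIdeal.units_smul β hI

/-- **`Brandt.ClassSet O₆` IS A POINT: `[J] = [O₆]` for every invertible right `O₆`-ideal `J`** (`h(O₆) = 1`).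
[cite: CerriChaubertLezowski2014, Prop. 2.5 (iii)] [cite: VignerasLNM800, Ch. III §5 (B) (nombre de classes)] -/
theorem classSet_mk_eq (I : rightIdeals (Submodule.span ℤ (Set.range ![(⟨1/2, 1/2, 1/2, -1/2⟩ : ℍ[ℚ,((-1 : ℤ) : ℚ),((3 : ℤ) : ℚ)]), ⟨0, 1, 0, 0⟩, ⟨0, 0, 1, 0⟩, ⟨0, 0, 0, 1⟩]))) :
    Quotient.mk (rightClassSetoid (Submodule.span ℤ (Set.range ![(⟨1/2, 1/2, 1/2, -1/2⟩ : ℍ[ℚ,((-1 : ℤ) : ℚ),((3 : ℤ) : ℚ)]), ⟨0, 1, 0, 0⟩, ⟨0, 0, 1, 0⟩, ⟨0, 0, 0, 1⟩]))) I = Quotient.mk (rightClassSetoid (Submodule.span ℤ (Set.range ![(⟨1/2, 1/2, 1/2, -1/2⟩ : ℍ[ℚ,((-1 : ℤ) : ℚ),((3 : ℤ) : ℚ)]), ⟨0, 1, 0, 0⟩, ⟨0, 0, 1, 0⟩, ⟨0, 0, 0, 1⟩]))) ⟨(Submodule.span ℤ (Set.range ![(⟨1/2, 1/2, 1/2, -1/2⟩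 : ℍ[ℚ,((-1 : ℤ) : ℚ),((3 : ℤ) : ℚ)]), ⟨0, 1, 0, 0⟩, ⟨0, 0, 1, 0⟩, ⟨0, 0, 0, 1⟩])), maxOrderLattice_mem_rightIdeals⟩ := by
  obtain ⟨b, hb⟩ := exists_eq_units_smul_of_mem_rightIdeals I.2
  apply Quotient.sound
  exact ⟨b⁻¹, by rw [hb, inv_smul_smul]⟩

/-- Every class of `Brandt.ClassSet O₆` is the class of `O₆`. [cite: CerriChaubertLezowski2014, Prop. 2.5 (iii)] -/
theorem classSet_eq (c : ClassSet (Submodule.span ℤ (Set.range ![(⟨1/2, 1/2, 1/2, -1/2⟩ : ℍ[ℚ,((-1 : ℤ) : ℚ),((3 : ℤ) : ℚ)]), ⟨0, 1, 0, 0⟩, ⟨0, 0, 1, 0⟩, ⟨0, 0, 0, 1⟩]))) :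
    c = Quotient.mk (rightClassSetoid (Submodule.span ℤ (Set.range ![(⟨1/2, 1/2, 1/2, -1/2⟩ : ℍ[ℚ,((-1 : ℤ) : ℚ),((3 : ℤ) : ℚ)]), ⟨0, 1, 0, 0⟩, ⟨0, 0, 1, 0⟩, ⟨0, 0, 0, 1⟩]))) ⟨(Submodule.span ℤ (Set.range ![(⟨1/2, 1/2, 1/2, -1/2⟩ : ℍ[ℚ,((-1 : ℤ) : ℚ),((3 : ℤ) : ℚ)]), ⟨0, 1, 0, 0⟩, ⟨0, 0, 1, 0⟩, ⟨0, 0, 0, 1⟩])), maxOrderLattice_mem_rightIdeals⟩ := by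
  induction c using Quotient.inductionOn with
  | h I => exact classSet_mk_eq I

/-- The hypotheses `Brandt.CoreHyp O₆ γ O₆` of the orbit correspondence hold for every non-central `γ`.
[cite: VignerasLNM800, Ch. III §5 Thm. 5.11 (proof (2))] -/
theorem coreHyp_maxOrderLattice {γ : ℍ[ℚ,((-1 : ℤ) : ℚ),((3 : ℤ) : ℚ)]} (hγ : γ ∉ (⊥ : Subalgebra ℚ ℍ[ℚ,((-1 : ℤ) : ℚ),((3 : ℤ) : ℚ)])) : CoreHyp (Submodule.span ℤ (Set.range ![(⟨1/2, 1/2, 1/2, -1/2⟩ : ℍ[ℚ,((-1 : ℤ) : ℚ),((3 : ℤ) : ℚ)]), ⟨0, 1, 0, 0⟩, ⟨0, 0, 1, 0⟩, ⟨0, 0, 0, 1⟩])) γ (Submodule.span ℤ (Set.range ![(⟨1/2, 1/2, 1/2, -1/2⟩ : ℍ[ℚ,((-1 : ℤ) : ℚ),((3 : ℤ) : ℚ)]), ⟨0, 1, 0, 0⟩, ⟨0, 0, 1, 0⟩, ⟨0, 0, 0, 1⟩])) :=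
  ⟨forall_isUnit_neg_one_three, fun _ hJ β => units_smul_mem_rightIdeals hJ β, hγ, maxOrderLattice_mem_rightIdeals⟩

/-- Every class of ideals through `γ` lies over the (unique) ideal class `[O₆]`. [cite: VignerasLNM800, Ch. III §5 Thm. 5.11 (proof (2))] -/
theorem throughClass_cls_eq {γ : ℍ[ℚ,((-1 : ℤ) : ℚ),((3 : ℤ) : ℚ)]} (q : ThroughClass (Submodule.span ℤ (Set.range ![(⟨1/2, 1/2, 1/2, -1/2⟩ : ℍ[ℚ,((-1 : ℤ) : ℚ),((3 : ℤ) : ℚ)]), ⟨0, 1, 0, 0⟩, ⟨0, 0, 1, 0⟩, ⟨0, 0, 0, 1⟩])) γ) :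
    q.cls = Quotient.mk (rightClassSetoid (Submodule.span ℤ (Set.range ![(⟨1/2, 1/2, 1/2, -1/2⟩ : ℍ[ℚ,((-1 : ℤ) : ℚ),((3 : ℤ) : ℚ)]), ⟨0, 1, 0, 0⟩, ⟨0, 0, 1, 0⟩, ⟨0, 0, 0, 1⟩]))) ⟨(Submodule.span ℤ (Set.range ![(⟨1/2, 1/2, 1/2, -1/2⟩ : ℍ[ℚ,((-1 : ℤ) : ℚ),((3 : ℤ) : ℚ)]), ⟨0, 1, 0, 0⟩, ⟨0, 0, 1, 0⟩, ⟨0, 0, 0, 1⟩])), maxOrderLattice_mem_rightIdeals⟩ :=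
  classSet_eq q.cls

end Principal

/-! ## §2 The element side: `traceNormSet O₆ (trd γ) (nrd γ) = {ŷ : y ∈ L(m)}` -/

section Elements

/-- The left order of the lattice `O₆` is `O₆`. [cite: VignerasLNM800, Ch. I §4 (ordre à gauche)] -/
theorem leftOrder_maxOrderLattice : leftOrder (Submodule.span ℤ (Set.range ![(⟨1/2, 1/2, 1/2, -1/2⟩ : ℍ[ℚ,((-1 : ℤ) : ℚ),((3 : ℤ) : ℚ)]), ⟨0, 1, 0, 0⟩, ⟨0, 0, 1, 0⟩, ⟨0, 0, 0, 1⟩])) = (Submodule.span ℤ (Set.range ![(⟨1/2, 1/2, 1/2, -1/2⟩ : ℍ[ℚ,((-1 : ℤ) : ℚ),((3 : ℤ) : ℚ)]), ⟨0, 1, 0, 0⟩, ⟨0, 0, 1, 0⟩, ⟨0, 0, 0, 1⟩])) :=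
  leftOrder_eq_self_of_one_mem one_mem_maxOrderLattice fun _ ha _ hb => mul_mem_maxOrderLattice ha hb

/-- A trace-zero element of `O₆` has integral coordinates: it is `ŷ` for an integer triple `y`. [cite: BayerTravesa2007, §1 p. 316] -/
theorem exists_pureVec_eq_of_maxOrder_re_eq_zero {x : ℍ[ℚ,((-1 : ℤ) : ℚ),((3 : ℤ) : ℚ)]} (hx : (x ∈ order (-1) 3 ∨ x - ⟨1/2, 1/2, 1/2, -1/2⟩ ∈ order (-1) 3)) (hre : x.re = 0) :
    ∃ y : ℤ × ℤ × ℤ, x = ⟨0, y.1, y.2.1, y.2.2⟩ := by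
  obtain ⟨n, rfl, ⟨q1, h1⟩, ⟨q2, h2⟩, ⟨q3, h3⟩⟩ := (maxOrder_iff_exists_halfCoords x).1 hx
  have hn0 : n 0 = 0 := by
    have h : (n 0 : ℚ) / 2 = 0 := hre
    exact_mod_cast (by linarith : (n 0 : ℚ) = 0)
  refine ⟨(-q1, -q2, -q3), ?_⟩
  have e1 : (n 1 : ℚ) = 2 * (-q1) := by exact_mod_cast (show n 1 = 2 * (-q1) by omega)
  have e2 : (n 2 : ℚ) = 2 * (-q2) := by exact_mod_cast (show n 2 = 2 * (-q2) by omega)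
  have e3 : (n 3 : ℚ) = 2 * (-q3) := by exact_mod_cast (show n 3 = 2 * (-q3) by omega)
  have e0 : (n 0 : ℚ) = 0 := by exact_mod_cast hn0
  rw [QuaternionAlgebra.mk.injEq]
  push_cast
  refine ⟨by rw [e0]; ring, by rw [e1]; ring, by rw [e2]; ring, by rw [e3]; ring⟩

/-- **`x ∈ traceNormSet O₆ (trd γ) (nrd γ) ⟺ x = ŷ` with `y ∈ L(m)`** for a pure `γ` of norm `m`: the elements of
`O_L(O₆) = O₆` with the characteristic polynomial `X² + m` of `γ` are exactly KRY's special vectors of norm `m`.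
[cite: VignerasLNM800, Ch. III §5 Thm. 5.11 (proof (2)) and Cor. 5.14] [cite: KudlaRapoportYang2006, §3.4 (3.4.8)] -/
theorem mem_traceNormSet_maxOrderLattice_iff {γ : ℍ[ℚ,((-1 : ℤ) : ℚ),((3 : ℤ) : ℚ)]} (hγ0 : γ.re = 0) {m : ℤ} (hγm : (γ * star γ).re = m)
    (x : ℍ[ℚ,((-1 : ℤ) : ℚ),((3 : ℤ) : ℚ)]) :
    x ∈ (traceNormSet (Submodule.span ℤ (Set.range ![(⟨1/2, 1/2, 1/2, -1/2⟩ : ℍ[ℚ,((-1 : ℤ) : ℚ),((3 : ℤ) : ℚ)]), ⟨0, 1, 0, 0⟩, ⟨0, 0, 1, 0⟩, ⟨0, 0, 0, 1⟩])) (reducedTrace ℚ ℍ[ℚ,((-1 : ℤ) : ℚ),((3 : ℤ) : ℚ)] γ) (reducedNorm ℚ ℍ[ℚ,((-1 : ℤ) : ℚ),((3 : ℤ) : ℚ)] γ)) ↔ ∃ y : {x : ℤ × ℤ × ℤ // x.1 ^ 2 - 3 * x.2.1 ^ 2 - 3 * x.2.2 ^ 2 = m}, x = ⟨0, y.1.1,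 y.1.2.1, y.1.2.2⟩ := by
  rw [mem_traceNormSet_iff, leftOrder_maxOrderLattice, reducedTrace_eq_two_mul_re, reducedTrace_eq_two_mul_re,
    reducedNorm_eq_re_mul_star, reducedNorm_eq_re_mul_star, hγ0, hγm, mul_zero, mem_maxOrderLattice_iff]
  constructor
  · rintro ⟨hx, hre, hn⟩
    obtain ⟨y, rfl⟩ := exists_pureVec_eq_of_maxOrder_re_eq_zero hx (by linarith)
    refine ⟨⟨y, ?_⟩, rfl⟩
    rw [re_mul_star_eq_coords] at hn
    simp only at hn
    exact_mod_cast (by linarith : ((y.1 : ℚ)) ^ 2 - 3 * (y.2.1 : ℚ) ^ 2 - 3 * (y.2.2 : ℚ) ^ 2 = m)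
  · rintro ⟨y, rfl⟩
    refine ⟨Or.inl ⟨![0, y.1.1, y.1.2.1, y.1.2.2], ?_⟩, by simp, ?_⟩
    · unfold ofCoords
      rw [QuaternionAlgebra.mk.injEq]
      simp
    · rw [re_mul_star_eq_coords]
      have h := y.2
      simp only
      have h' : ((y.1.1 : ℤ) : ℚ) ^ 2 - 3 * ((y.1.2.1 : ℤ) : ℚ) ^ 2 - 3 * ((y.1.2.2 : ℤ) : ℚ) ^ 2 = (m : ℚ) := by
        exact_mod_cast h
      linear_combination h'

/-- The special vector `ŷ`, `y ∈ L(m)`, as an element of `traceNormSet O₆ (trd γ) (nrd γ)`. [cite: KudlaRapoportYang2006, §3.4 (3.4.8)] -/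
theorem pureVec_mem_traceNormSet {γ : ℍ[ℚ,((-1 : ℤ) : ℚ),((3 : ℤ) : ℚ)]} (hγ0 : γ.re = 0) {m : ℤ} (hγm : (γ * star γ).re = m) (y : {x : ℤ × ℤ × ℤ // x.1 ^ 2 - 3 * x.2.1 ^ 2 - 3 * x.2.2 ^ 2 = m}) :
    (⟨0, y.1.1, y.1.2.1, y.1.2.2⟩ : ℍ[ℚ,((-1 : ℤ) : ℚ),((3 : ℤ) : ℚ)]) ∈ (traceNormSet (Submodule.span ℤ (Set.range ![(⟨1/2, 1/2, 1/2, -1/2⟩ : ℍ[ℚ,((-1 : ℤ) : ℚ),((3 : ℤ) : ℚ)]), ⟨0, 1, 0, 0⟩, ⟨0, 0, 1, 0⟩, ⟨0, 0, 0, 1⟩])) (reducedTrace ℚ ℍ[ℚ,((-1 : ℤ) : ℚ),((3 : ℤ) : ℚ)] γ) (reducedNorm ℚ ℍ[ℚ,((-1 : ℤ) : ℚ),((3 : ℤ) : ℚ)] γ)) :=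
  (mem_traceNormSet_maxOrderLattice_iff hγ0 hγm _).2 ⟨y, rfl⟩

/-- `y ↦ ŷ` is injective on integer triples. [folklore] -/
private theorem pureVec_injective₆₂ {y y' : ℤ × ℤ × ℤ}
    (h : (⟨0, y.1, y.2.1, y.2.2⟩ : ℍ[ℚ,((-1 : ℤ) : ℚ),((3 : ℤ) : ℚ)]) = ⟨0, y'.1, y'.2.1, y'.2.2⟩) : y = y' := by
  have h1 : (y.1 : ℚ) = y'.1 := by simpa using congrArg QuaternionAlgebra.imI h
  have h2 : (y.2.1 : ℚ) = y'.2.1 := by simpa using congrArg QuaternionAlgebra.imJ h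
  have h3 : (y.2.2 : ℚ) = y'.2.2 := by simpa using congrArg QuaternionAlgebra.imK h
  exact Prod.ext (by exact_mod_cast h1) (Prod.ext (by exact_mod_cast h2) (by exact_mod_cast h3))

/-- **The stabiliser of the lattice `O₆` in `Bˣ` relates special vectors exactly as KRY's `Γ = O₆^×` does**:
`ŷ' = uŷu⁻¹` for some `u` with `uO₆ = O₆` iff `vŷ = ŷ'v` for some `v ∈ O₆`, `nr v = ±1`.
[cite: KudlaRapoportYang2006, §3.4 (3.4.13) («`Γ = O_B^×`»)] [cite: VignerasLNM800, Ch. I §4 Lemme 4.12] -/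
theorem exists_stabilizer_conj_iff (y y' : ℤ × ℤ × ℤ) :
    (∃ u : (ℍ[ℚ,((-1 : ℤ) : ℚ),((3 : ℤ) : ℚ)])ˣ, u • (Submodule.span ℤ (Set.range ![(⟨1/2, 1/2, 1/2, -1/2⟩ : ℍ[ℚ,((-1 : ℤ) : ℚ),((3 : ℤ) : ℚ)]), ⟨0, 1, 0, 0⟩, ⟨0, 0, 1, 0⟩, ⟨0, 0, 0, 1⟩])) = (Submodule.span ℤ (Set.range ![(⟨1/2, 1/2, 1/2, -1/2⟩ : ℍ[ℚ,((-1 : ℤ) : ℚ),((3 : ℤ) : ℚ)]), ⟨0, 1, 0, 0⟩, ⟨0, 0, 1, 0⟩, ⟨0, 0, 0, 1⟩])) ∧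
        (u : ℍ[ℚ,((-1 : ℤ) : ℚ),((3 : ℤ) : ℚ)]) * ⟨0, y.1, y.2.1, y.2.2⟩ * ((u⁻¹ : (ℍ[ℚ,((-1 : ℤ) : ℚ),((3 : ℤ) : ℚ)])ˣ) : ℍ[ℚ,((-1 : ℤ) : ℚ),((3 : ℤ) : ℚ)]) = ⟨0, y'.1, y'.2.1, y'.2.2⟩) ↔
      ∃ v : ℍ[ℚ,((-1 : ℤ) : ℚ),((3 : ℤ) : ℚ)], (v ∈ order (-1) 3 ∨ v - ⟨1/2, 1/2, 1/2, -1/2⟩ ∈ order (-1) 3) ∧ ((v * star v).re = 1 ∨ (v * star v).re = -1) ∧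
        v * ⟨0, y.1, y.2.1, y.2.2⟩ = ⟨0, y'.1, y'.2.1, y'.2.2⟩ * v := by
  constructor
  · rintro ⟨u, hu, hconj⟩
    obtain ⟨hmem, hun⟩ := (units_smul_maxOrderLattice_eq_iff u).1 hu
    refine ⟨u, hmem, hun, ?_⟩
    rw [← hconj, mul_assoc, mul_assoc, Units.inv_mul, mul_one]
  · rintro ⟨v, hv, hn, hconj⟩
    have hv0 : v ≠ 0 := by
      rintro rfl
      rw [zero_mul, QuaternionAlgebra.re_zero] at hn
      rcases hn with h | h <;> norm_num at h
    obtain ⟨u, hu⟩ := isUnit_of_ne_zero hv0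
    refine ⟨u, (units_smul_maxOrderLattice_eq_iff u).2 ⟨by rw [hu]; exact hv, by rw [hu]; exact hn⟩, ?_⟩
    rw [hu, hconj, mul_assoc, ← hu, Units.mul_inv, mul_one]

end Elements

/-! ## §3 `#(ThroughClass O₆ γ) = |L(m)/O₆^×|` -/

section Classes

/-- **The class map is constant on `O₆^×`-orbits**: `O₆^×`-conjugate special vectors give the same class `ψ(ŷ)` of
ideals through `γ`. [cite: VignerasLNM800, Ch. III §5 Thm. 5.11 (proof (2))] -/
theorem psi_pureVec_eq_of_conj [IsQuaternionAlgebra ℚ ℍ[ℚ,((-1 : ℤ) : ℚ),((3 : ℤ) : ℚ)]] {γ : ℍ[ℚ,((-1 : ℤ) : ℚ),((3 : ℤ) : ℚ)]} (hγ : γ ∉ (⊥ : Subalgebra ℚ ℍ[ℚ,((-1 : ℤ) : ℚ),((3 : ℤ) : ℚ)])) (hγ0 : γ.re = 0) {m : ℤ}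
    (hγm : (γ * star γ).re = m) {y y' : {x : ℤ × ℤ × ℤ // x.1 ^ 2 - 3 * x.2.1 ^ 2 - 3 * x.2.2 ^ 2 = m}}
    (h : ∃ v : ℍ[ℚ,((-1 : ℤ) : ℚ),((3 : ℤ) : ℚ)], (v ∈ order (-1) 3 ∨ v - ⟨1/2, 1/2, 1/2, -1/2⟩ ∈ order (-1) 3) ∧ ((v * star v).re = 1 ∨ (v * star v).re = -1) ∧ v * ⟨0, y.1.1, y.1.2.1, y.1.2.2⟩ = ⟨0, y'.1.1, y'.1.2.1, y'.1.2.2⟩ * v) :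
    (coreHyp_maxOrderLattice hγ).psi ⟨_, pureVec_mem_traceNormSet hγ0 hγm y⟩ =
      (coreHyp_maxOrderLattice hγ).psi ⟨_, pureVec_mem_traceNormSet hγ0 hγm y'⟩ := by
  obtain ⟨u, hu, hconj⟩ := (exists_stabilizer_conj_iff y.1 y'.1).2 h
  have key : (⟨u, MulAction.mem_stabilizer_iff.2 hu⟩ : MulAction.stabilizer (ℍ[ℚ,((-1 : ℤ) : ℚ),((3 : ℤ) : ℚ)])ˣ (Submodule.span ℤ (Set.range ![(⟨1/2, 1/2, 1/2, -1/2⟩ : ℍ[ℚ,((-1 : ℤ) : ℚ),((3 : ℤ) : ℚ)]), ⟨0, 1, 0, 0⟩, ⟨0, 0, 1, 0⟩, ⟨0, 0, 0, 1⟩]))) •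
      (⟨_, pureVec_mem_traceNormSet hγ0 hγm y⟩ : (traceNormSet (Submodule.span ℤ (Set.range ![(⟨1/2, 1/2, 1/2, -1/2⟩ : ℍ[ℚ,((-1 : ℤ) : ℚ),((3 : ℤ) : ℚ)]), ⟨0, 1, 0, 0⟩, ⟨0, 0, 1, 0⟩, ⟨0, 0, 0, 1⟩])) (reducedTrace ℚ ℍ[ℚ,((-1 : ℤ) : ℚ),((3 : ℤ) : ℚ)] γ) (reducedNorm ℚ ℍ[ℚ,((-1 : ℤ) : ℚ),((3 : ℤ) : ℚ)] γ))) = ⟨_, pureVec_mem_traceNormSet hγ0 hγm y'⟩ :=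
    Subtype.ext hconj
  rw [← key, CoreHyp.psi_smul]

/-- **The class map separates `O₆^×`-orbits**: `ψ(ŷ) = ψ(ŷ')` iff `y`, `y'` are `O₆^×`-conjugate.
[cite: VignerasLNM800, Ch. III §5 Thm. 5.11 (proof (2))] -/
theorem psi_pureVec_eq_iff [IsQuaternionAlgebra ℚ ℍ[ℚ,((-1 : ℤ) : ℚ),((3 : ℤ) : ℚ)]] {γ : ℍ[ℚ,((-1 : ℤ) : ℚ),((3 : ℤ) : ℚ)]} (hγ : γ ∉ (⊥ : Subalgebra ℚ ℍ[ℚ,((-1 : ℤ) : ℚ),((3 : ℤ) : ℚ)])) (hγ0 : γ.re = 0) {m : ℤ}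
    (hγm : (γ * star γ).re = m) (y y' : {x : ℤ × ℤ × ℤ // x.1 ^ 2 - 3 * x.2.1 ^ 2 - 3 * x.2.2 ^ 2 = m}) :
    (coreHyp_maxOrderLattice hγ).psi ⟨_, pureVec_mem_traceNormSet hγ0 hγm y⟩ =
      (coreHyp_maxOrderLattice hγ).psi ⟨_, pureVec_mem_traceNormSet hγ0 hγm y'⟩ ↔
      ∃ v : ℍ[ℚ,((-1 : ℤ) : ℚ),((3 : ℤ) : ℚ)], (v ∈ order (-1) 3 ∨ v - ⟨1/2, 1/2, 1/2, -1/2⟩ ∈ order (-1) 3) ∧ ((v * star v).re = 1 ∨ (v * star v).re = -1) ∧ v * ⟨0, y.1.1, y.1.2.1, y.1.2.2⟩ = ⟨0, y'.1.1, y'.1.2.1, y'.1.2.2⟩ * v := by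
  refine ⟨fun h => ?_, psi_pureVec_eq_of_conj hγ hγ0 hγm⟩
  obtain ⟨u, hu⟩ := (coreHyp_maxOrderLattice hγ).exists_smul_eq_of_psi_eq h
  have hu' := congrArg Subtype.val hu
  rw [conjAction_smul_val] at hu'
  exact (exists_stabilizer_conj_iff y.1 y'.1).1 ⟨u, MulAction.mem_stabilizer_iff.1 u.2, hu'⟩

/-- **Every class of ideals through `γ` is `ψ(ŷ)` for a special vector `y ∈ L(m)`** (one ideal class; Skolem–Noether).
[cite: VignerasLNM800, Ch. III §5 Thm. 5.11 (proof (2)); Ch. I §2 Thm. 2.1] -/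
theorem exists_pureVec_psi_eq [IsQuaternionAlgebra ℚ ℍ[ℚ,((-1 : ℤ) : ℚ),((3 : ℤ) : ℚ)]] {γ : ℍ[ℚ,((-1 : ℤ) : ℚ),((3 : ℤ) : ℚ)]} (hγ : γ ∉ (⊥ : Subalgebra ℚ ℍ[ℚ,((-1 : ℤ) : ℚ),((3 : ℤ) : ℚ)])) (hγ0 : γ.re = 0) {m : ℤ}
    (hγm : (γ * star γ).re = m) (q : ThroughClass (Submodule.span ℤ (Set.range ![(⟨1/2, 1/2, 1/2, -1/2⟩ : ℍ[ℚ,((-1 : ℤ) : ℚ),((3 : ℤ) : ℚ)]), ⟨0, 1, 0, 0⟩, ⟨0, 0, 1, 0⟩, ⟨0, 0, 0, 1⟩])) γ) :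
    ∃ y : {x : ℤ × ℤ × ℤ // x.1 ^ 2 - 3 * x.2.1 ^ 2 - 3 * x.2.2 ^ 2 = m}, (coreHyp_maxOrderLattice hγ).psi ⟨_, pureVec_mem_traceNormSet hγ0 hγm y⟩ = q := by
  obtain ⟨x, hx⟩ := (coreHyp_maxOrderLattice hγ).exists_psi_eq (throughClass_cls_eq q)
  obtain ⟨y, hy⟩ := (mem_traceNormSet_maxOrderLattice_iff hγ0 hγm x.1).1 x.2
  refine ⟨y, ?_⟩
  rw [← hx]
  congr 1
  exact Subtype.ext hy.symm

/-- **`#(Brandt.ThroughClass O₆ γ) = |L(m)/O₆^×|`** for every pure `γ ∈ B` of reduced norm `m`: the classes modulo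
`ℚ(γ)ˣ` of (invertible, here principal) right `O₆`-ideals through `γ` are in bijection with KRY's `Γ`-orbits of special
vectors of norm `m` — Vignéras III.5.11 (2) for `O₆` (`h = 1`), `[y] ↦ ψ(ŷ)`.
[cite: VignerasLNM800, Ch. III §5 Thm. 5.11 (proof (2)) and Cor. 5.14] [cite: KudlaRapoportYang2006, §3.4 (3.4.13)] -/
theorem card_throughClass_eq_card_unit_classes {γ : ℍ[ℚ,((-1 : ℤ) : ℚ),((3 : ℤ) : ℚ)]} (hγ : γ ∉ (⊥ : Subalgebra ℚ ℍ[ℚ,((-1 : ℤ) : ℚ),((3 : ℤ) : ℚ)])) (hγ0 : γ.re = 0)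
    {m : ℤ} (hγm : (γ * star γ).re = m) :
    Nat.card (ThroughClass (Submodule.span ℤ (Set.range ![(⟨1/2, 1/2, 1/2, -1/2⟩ : ℍ[ℚ,((-1 : ℤ) : ℚ),((3 : ℤ) : ℚ)]), ⟨0, 1, 0, 0⟩, ⟨0, 0, 1, 0⟩, ⟨0, 0, 0, 1⟩])) γ) = Nat.card (Quot (fun x y : {x : ℤ × ℤ × ℤ // x.1 ^ 2 - 3 * x.2.1 ^ 2 - 3 * x.2.2 ^ 2 = m} ↦
      ∃ v : ℍ[ℚ,((-1 : ℤ) : ℚ),((3 : ℤ) : ℚ)], (v ∈ order (-1) 3 ∨ v - ⟨1/2, 1/2, 1/2, -1/2⟩ ∈ order (-1) 3) ∧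
        ((v * star v).re = 1 ∨ (v * star v).re = -1) ∧
        v * ⟨0, x.1.1, x.1.2.1, x.1.2.2⟩ = ⟨0, y.1.1, y.1.2.1, y.1.2.2⟩ * v)) := by
  haveI := isQuaternionAlgebra_neg_one_three
  set H := coreHyp_maxOrderLattice hγ with hH
  let Φ : (Quot (fun x y : {x : ℤ × ℤ × ℤ // x.1 ^ 2 - 3 * x.2.1 ^ 2 - 3 * x.2.2 ^ 2 = m} ↦
      ∃ v : ℍ[ℚ,((-1 : ℤ) : ℚ),((3 : ℤ) : ℚ)], (v ∈ order (-1) 3 ∨ v - ⟨1/2, 1/2, 1/2, -1/2⟩ ∈ order (-1) 3) ∧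
        ((v * star v).re = 1 ∨ (v * star v).re = -1) ∧
        v * ⟨0, x.1.1, x.1.2.1, x.1.2.2⟩ = ⟨0, y.1.1, y.1.2.1, y.1.2.2⟩ * v)) → ThroughClass (Submodule.span ℤ (Set.range ![(⟨1/2, 1/2, 1/2, -1/2⟩ : ℍ[ℚ,((-1 : ℤ) : ℚ),((3 : ℤ) : ℚ)]), ⟨0, 1, 0, 0⟩, ⟨0, 0, 1, 0⟩, ⟨0, 0, 0, 1⟩])) γ :=
    Quot.lift (fun y : {x : ℤ × ℤ × ℤ // x.1 ^ 2 - 3 * x.2.1 ^ 2 - 3 * x.2.2 ^ 2 = m} => H.psi ⟨_, pureVec_mem_traceNormSet hγ0 hγm y⟩)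
      (fun y y' h => psi_pureVec_eq_of_conj hγ hγ0 hγm h)
  refine (Nat.card_eq_of_bijective Φ ⟨?_, ?_⟩).symm
  · intro a b
    induction a using Quot.ind with
    | _ y =>
      induction b using Quot.ind with
      | _ y' =>
        intro h
        exact Quot.sound ((psi_pureVec_eq_iff hγ hγ0 hγm y y').1 h)
  · intro q
    obtain ⟨y, hy⟩ := exists_pureVec_psi_eq hγ hγ0 hγm q
    exact ⟨Quot.mk _ y, hy⟩

/-- **For `y₀ ∈ L(m)`: `#(ThroughClass O₆ ŷ₀) = |L(m)/O₆^×|`** — the count of the abstract theory at a special vector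
itself. [cite: VignerasLNM800, Ch. III §5 Thm. 5.11 and Cor. 5.14] [cite: KudlaRapoportYang2006, §3.4 (3.4.13)] -/
theorem card_throughClass_pureVec_eq_card_unit_classes {m : ℤ} (hm : m ≠ 0) (y₀ : {x : ℤ × ℤ × ℤ // x.1 ^ 2 - 3 * x.2.1 ^ 2 - 3 * x.2.2 ^ 2 = m}) :
    Nat.card (ThroughClass (Submodule.span ℤ (Set.range ![(⟨1/2, 1/2, 1/2, -1/2⟩ : ℍ[ℚ,((-1 : ℤ) : ℚ),((3 : ℤ) : ℚ)]), ⟨0, 1, 0, 0⟩, ⟨0, 0, 1, 0⟩, ⟨0, 0, 0, 1⟩])) (⟨0, y₀.1.1, y₀.1.2.1, y₀.1.2.2⟩ : ℍ[ℚ,((-1 : ℤ) : ℚ),((3 : ℤ) : ℚ)])) = Nat.card (Quot (fun x y : {x : ℤ × ℤ × ℤ // x.1 ^ 2 - 3 * x.2.1 ^ 2 - 3 * x.2.2 ^ 2 = m} ↦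
      ∃ v : ℍ[ℚ,((-1 : ℤ) : ℚ),((3 : ℤ) : ℚ)], (v ∈ order (-1) 3 ∨ v - ⟨1/2, 1/2, 1/2, -1/2⟩ ∈ order (-1) 3) ∧
        ((v * star v).re = 1 ∨ (v * star v).re = -1) ∧
        v * ⟨0, x.1.1, x.1.2.1, x.1.2.2⟩ = ⟨0, y.1.1, y.1.2.1, y.1.2.2⟩ * v)) :=
  card_throughClass_eq_card_unit_classes (pureVec_not_mem_bot_of_norm_ne_zero y₀.2 hm) rfl
    (by
      rw [re_mul_star_eq_coords]
      have h' : ((y₀.1.1 : ℤ) : ℚ) ^ 2 - 3 * ((y₀.1.2.1 : ℤ) : ℚ) ^ 2 - 3 * ((y₀.1.2.2 : ℤ) : ℚ) ^ 2 = (m : ℚ) := by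
        exact_mod_cast y₀.2
      show (0 : ℚ) ^ 2 + (y₀.1.1 : ℚ) ^ 2 - 3 * (y₀.1.2.1 : ℚ) ^ 2 - 3 * (y₀.1.2.2 : ℚ) ^ 2 = m
      linear_combination h')

end Classes

end Literature.Geometry.Kaehler.ComplexTorus.QuaternionType
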